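import Summits.HodgeConjecture.HodgeConjecture.Theorems.F0P3cStCharTSNewtonChartHaar   -- ★ (C3) `map_restrict_eq_smul_haar`, `measure_image_eq` (brings (C1a)(C1b))
import Literature.NumberTheory.Weil1982.CayleyProductSandwich                           -- ★ (C2) p851775: `cayley_mul_cayley_eq_cayley`, `valBound_cayleySandwich{,_incr,_sub_add}`, `eq_of_cayley_eq_cayley`
import Mathlib.NumberTheory.LocalField.Basic
import Mathlib.GroupTheory.ArchimedeanDensely
import HarnessLib

/-!
# F0 · P3c · line LH6 «StCharTS» — WIF antecedent, ELLIPTIC half via the ★ Cayley window: brick (C4) «THE CAYLEY CHART OF A CLOSED MATRIX GROUP CARRIES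
# HAAR MEASURE» — additive Haar measure of the Lie ball, pushed through `X ↦ c(X) = (1 + X)(1 − X)⁻¹`, is a constant multiple of Haar measure on the window

Cell `pub/hodgecm-mathlib`, crux H413 = `stmt-HodgeConjecture-24833` (lane `--supports … --as helper`), route HCCMUnconditional; seat LH5-p02 (g6); ROAD «JAC-ELL» v0
(`F0/P3c/LH5/LH5-p02/g6/ROAD-JAC-ELL.v0.LH5p02g6.md`) brick C4.  THEOREMS ONLY (no definition ∕ instance ∕ notation ∕ named fact ∕ `sorry`); Mathlib + ★ (C1)(C2)(C3).

SETTING (abstract embeddings, so that `GL_n(F)` itself AND every closed matrix group — `U(J)(K)` — is an instance WITHOUT subtype juggling in this file).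
`F` a non-archimedean local field with `2 ≠ 0` (Mathlib `IsNonarchimedeanLocalField`; entrywise bounds ★ `ValBound`), `m` a finite index type.
* the LIE SIDE: an additive group `V` (Hausdorff, second countable, Borel, additive Haar measure `μ`) with a CLOSED EMBEDDING `ι : V →+ Matrix m m F`, and a level
  sequence `Λ : ℕ → AddSubgroup V` given BY HYPOTHESIS `hΛ : X ∈ Λ j ↔ ValBound (α^(j+1)) (ι X)` (`0 ≠ α < 1`; no definition is introduced — the consumer's
  `Λ` is e.g. `𝔲 ∩ {ValBound α^(j+1)}`), and a «product in the chart» `σ : V → V → V` with `ι (σ W X) = S(ι W, ι X) := (1 − ιW)⁻¹(ιW + ιX)(1 + ιW ιX)⁻¹(1 − ιW)`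
  on `Λ 0 × Λ 0` (for `V = M_m(F)`: `σ = S`; for `𝔲(J)`: `S` is again `J`-skew, ★ `transpose_map_mul_add_mul_eq_zero_of_unitary`);
* the GROUP SIDE: a second countable locally compact group `G` (Haar measure `ν`) with an injective inducing homomorphism `ρ : G →* GL m F`, and a CHART
  `c : V → G` with `ρ (c X) = c(ι X)` (as matrices) on `Λ 0`, whose image contains a `ρ`-ball: `hwin : ValBound β (ρ g − 1) → g ∈ c '' Λ 0` (`β ≠ 0`; the
  inverse window, ★ `UnitaryFinCayleyWindowIndex` §3 pattern — for `U(J)` the preimage `(g − 1)(g + 1)⁻¹` is skew).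

THE RESULTS (all PROVED).
* §1 algebra: `valBound_of_mem_level_zero`, `level_antitone`, `injOn_chart` (★ (C2) `eq_of_cayley_eq_cayley`), `sigma_mem_level_zero`, `sigma_zero`,
  `sigma_newton` (the filtered Newton hypothesis for `σ W`, ★ (C2) `valBound_cayleySandwich_incr`), `chart_sigma` (`c (σ W X) = c W · c X`, ★ (C2)
  `cayley_mul_cayley_eq_cayley`), `rho_chart_eq_cayleyGL`, `chart_inv` = hypothesis (I) of ★ (C3) (`W′ = −W`).
* §2 the levels: `isOpen_level`, `isCompact_level`, `eq_zero_of_forall_mem_level` (`⋂ Λ j = 0`, via `exists_pow_lt₀` — the value group of a local field is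
  archimedean), `exists_level_subset_of_mem_nhds` (neighbourhood basis, by compactness — ★ pattern of `exists_congruenceGL_subset`).
* §3 the chart: `continuousOn_cayley_smul`, `continuousOn_chart` (`continuousAt_matrix_inv`, units topology), `chart_translation_newton` = hypothesis (T) of
  ★ (C3) with `ψ = σ W`, `isOpen_image_chart` (the window contains the `ρ`-ball and is a product-closed carrier).
* §4 **`map_restrict_chart_eq_smul_haar`** — `(μ.restrict (Λ 0)).map c = (μ (Λ 0) ∕ ν K) • ν.restrict K`, `K = c '' Λ 0`; **`measure_chart_image_eq`** —
  `μ A = (μ (Λ 0) ∕ ν K) · ν (c '' A)` for `A ⊆ Λ 0` with Borel image (★ (C3)).  In words: ON THE WINDOW, HAAR MEASURE OF `G` IS THE CAYLEY IMAGE OF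
  ADDITIVE HAAR MEASURE OF THE LIE BALL, up to one explicit constant — the p-adic «`d(cay) = 1` at the origin» with no differential calculus.

HONEST LABEL: HC_CM is proved only modulo the 7 printed citations (2 remaining named inputs: hLiu418 = `stmt-HodgeConjecture-24832`, h413 =
`stmt-HodgeConjecture-24833`) until rung 0 closes; this file closes no organ (count-neutral bank for the elliptic half of the WIF antecedent of RUNG0).

## References
* [Serre1992LALG] J.-P. Serre, *Lie Algebras and Lie Groups*, LNM 1500 (1992), Part II Ch. IV §8–§9 (standard groups, their filtrations and Haar measure). Context locator.
* [PlatonovRapinchuk1994] V. Platonov, A. Rapinchuk, *Algebraic Groups and Number Theory* (1994), §3.3 (congruence subgroups via the Cayley map). Context locator.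
* [Helgason2000] S. Helgason, *Groups and Geometric Analysis* (2000), Ch. I §1 Thm. 1.14 (13) p. 96 (Haar measure in a chart). Context locator.
-/

set_option autoImplicit false
set_option linter.dupNamespace false

open Set Filter MeasureTheory MeasureTheory.Measure TopologicalSpace Topology Matrix ValuativeRel
open Literature.NumberTheory.Automorphic Literature.NumberTheory.Weil1982.UnitaryFinTopForm
open Summit.HodgeConjecture.HodgeConjecture.Cruxes.H413.F0P3cStCharTSFilteredNewton
open Summit.HodgeConjecture.HodgeConjecture.Cruxes.H413.F0P3cStCharTSNewtonChartHaar
open scoped Pointwise Topology ENNReal MatrixGroups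

namespace Summit.HodgeConjecture.HodgeConjecture.Cruxes.H413.F0P3cStCharTSCayleyChartHaar

/-! ## §1 Algebra of the levels and of the chart (no topology) -/

section Algebra

variable {F : Type*} [Field F] [ValuativeRel F] {m : Type*} [Fintype m] [DecidableEq m]
  {V : Type*} [AddCommGroup V] {G : Type*} [Group G]
  (ι : V →+ Matrix m m F) (Λ : ℕ → AddSubgroup V) {α : ValueGroupWithZero F}
  (ρ : G →* GL m F) (c : V → G) (σ : V → V → V)

omit [Fintype m] [DecidableEq m] in
/-- Membership in the base box: entries of `ι X` are `≤ α`. [cite: Serre1992LALG, Part II Ch. IV §9] -/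
theorem valBound_of_mem_level_zero (hΛ : ∀ j X, X ∈ Λ j ↔ ValBound (α ^ (j + 1)) (ι X)) {X : V} (hX : X ∈ Λ 0) :
    ValBound α (ι X) := by
  simpa using (hΛ 0 X).1 hX

omit [Fintype m] [DecidableEq m] in
/-- The levels decrease (`α ≤ 1`). [cite: Serre1992LALG, Part II Ch. IV §9] -/
theorem level_antitone (hΛ : ∀ j X, X ∈ Λ j ↔ ValBound (α ^ (j + 1)) (ι X)) (hα1 : α ≤ 1) : Antitone Λ := by
  intro i j hij X hX
  rw [hΛ] at hX ⊢
  exact hX.mono (pow_le_pow_right_of_le_one' hα1 (by omega))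

/-- **The chart is injective on the base box** (`2 ≠ 0`; ★ (C2) `eq_of_cayley_eq_cayley`). [cite: PlatonovRapinchuk1994, §3.3] -/
theorem injOn_chart (h2 : (2 : F) ≠ 0) (hinj : Function.Injective ι) (hΛ : ∀ j X, X ∈ Λ j ↔ ValBound (α ^ (j + 1)) (ι X)) (hα1 : α < 1)
    (hc : ∀ X ∈ Λ 0, ((ρ (c X) : GL m F) : Matrix m m F) = cayley (ι X)) : InjOn c (Λ 0 : Set V) := by
  intro X hX X' hX' h
  apply hinj
  refine eq_of_cayley_eq_cayley h2 (valBound_of_mem_level_zero ι Λ hΛ hX) (valBound_of_mem_level_zero ι Λ hΛ hX') hα1 ?_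
  rw [← hc X hX, ← hc X' hX', h]

/-- The chart product stays in the base box: `σ W X ∈ Λ 0` for `W, X ∈ Λ 0`. [cite: Serre1992LALG, Part II Ch. IV §8] -/
theorem sigma_mem_level_zero (hΛ : ∀ j X, X ∈ Λ j ↔ ValBound (α ^ (j + 1)) (ι X)) (hα1 : α < 1)
    (hσ : ∀ W ∈ Λ 0, ∀ X ∈ Λ 0, ι (σ W X) = (1 - ι W)⁻¹ * (ι W + ι X) * (1 + ι W * ι X)⁻¹ * (1 - ι W))
    {W X : V} (hW : W ∈ Λ 0) (hX : X ∈ Λ 0) : σ W X ∈ Λ 0 := by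
  rw [hΛ, zero_add, pow_one, hσ W hW X hX]
  simpa using valBound_cayleySandwich (valBound_of_mem_level_zero ι Λ hΛ hW) (valBound_of_mem_level_zero ι Λ hΛ hX) hα1 hα1

/-- `σ W 0 = W` (★ (C2) `cayleySandwich_zero`). [cite: Serre1992LALG, Part II Ch. IV §8] -/
theorem sigma_zero (hinj : Function.Injective ι) (hΛ : ∀ j X, X ∈ Λ j ↔ ValBound (α ^ (j + 1)) (ι X)) (hα1 : α < 1)
    (hσ : ∀ W ∈ Λ 0, ∀ X ∈ Λ 0, ι (σ W X) = (1 - ι W)⁻¹ * (ι W + ι X) * (1 + ι W * ι X)⁻¹ * (1 - ι W))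
    {W : V} (hW : W ∈ Λ 0) : σ W 0 = W := by
  obtain ⟨hWu, -, -⟩ := isUnit_det_one_sub_of_valBound (valBound_of_mem_level_zero ι Λ hΛ hW) hα1
  apply hinj
  rw [hσ W hW 0 (zero_mem _), map_zero, cayleySandwich_zero hWu]

/-- The filtered Newton hypothesis `(N)` for `σ W` at depth `0` (★ (C2) `valBound_cayleySandwich_incr`, one level gained because `W ≤ α`).
[cite: Serre1992LALG, Part II Ch. IV §8] -/
theorem sigma_newton (hΛ : ∀ j X, X ∈ Λ j ↔ ValBound (α ^ (j + 1)) (ι X)) (hα1 : α < 1)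
    (hσ : ∀ W ∈ Λ 0, ∀ X ∈ Λ 0, ι (σ W X) = (1 - ι W)⁻¹ * (ι W + ι X) * (1 + ι W * ι X)⁻¹ * (1 - ι W))
    {W : V} (hW : W ∈ Λ 0) :
    ∀ j, 0 ≤ j → ∀ x ∈ Λ 0, ∀ y ∈ Λ j, σ W (x + y) - σ W x - y ∈ Λ (j + 1) := by
  intro j _ x hx y hy
  have hWb := valBound_of_mem_level_zero ι Λ hΛ hW
  have hxb := valBound_of_mem_level_zero ι Λ hΛ hx
  have hyb : ValBound (α ^ (j + 1)) (ι y) := (hΛ j y).1 hy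
  have hα1' : α ^ (j + 1) ≤ α := by simpa using pow_le_pow_right_of_le_one' hα1.le (Nat.succ_le_succ (Nat.zero_le j))
  have hxy : x + y ∈ Λ 0 := add_mem hx ((level_antitone ι Λ hΛ hα1.le (Nat.zero_le j)) hy)
  rw [hΛ, map_sub, map_sub, hσ W hW (x + y) hxy, hσ W hW x hx, map_add]
  have key := valBound_cayleySandwich_incr (W := ι W) (X := ι x) (Y := ι y) hWb hxb hyb hα1 hα1 hα1'
  rw [show α ^ (j + 1 + 1) = α * α ^ (j + 1) by rw [pow_succ, mul_comm]]
  exact key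

/-- `c (σ W X) = c W · c X` (★ (C2) `cayley_mul_cayley_eq_cayley`, `ρ` injective). [cite: Serre1992LALG, Part II Ch. IV §8] -/
theorem chart_sigma (hΛ : ∀ j X, X ∈ Λ j ↔ ValBound (α ^ (j + 1)) (ι X)) (hα1 : α < 1)
    (hρinj : Function.Injective ρ) (hc : ∀ X ∈ Λ 0, ((ρ (c X) : GL m F) : Matrix m m F) = cayley (ι X))
    (hσ : ∀ W ∈ Λ 0, ∀ X ∈ Λ 0, ι (σ W X) = (1 - ι W)⁻¹ * (ι W + ι X) * (1 + ι W * ι X)⁻¹ * (1 - ι W))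
    {W X : V} (hW : W ∈ Λ 0) (hX : X ∈ Λ 0) : c (σ W X) = c W * c X := by
  have hWb := valBound_of_mem_level_zero ι Λ hΛ hW
  have hXb := valBound_of_mem_level_zero ι Λ hΛ hX
  obtain ⟨hWu, -, -⟩ := isUnit_det_one_sub_of_valBound hWb hα1
  obtain ⟨hXu, -, -⟩ := isUnit_det_one_sub_of_valBound hXb hα1
  obtain ⟨hBu, -, -⟩ := isUnit_det_one_add_mul_of_valBound hWb hXb hα1 hα1.le
  apply hρinj
  rw [map_mul]
  apply Units.ext
  rw [Units.val_mul, hc _ (sigma_mem_level_zero ι Λ σ hΛ hα1 hσ hW hX), hc W hW, hc X hX, hσ W hW X hX,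
    cayley_mul_cayley_eq_cayley hWu hXu hBu]

/-- The chart element of `X` is the unit `cayleyGL (ι X)`. [cite: PlatonovRapinchuk1994, §3.3] -/
theorem rho_chart_eq_cayleyGL (hΛ : ∀ j X, X ∈ Λ j ↔ ValBound (α ^ (j + 1)) (ι X)) (hα1 : α < 1)
    (hc : ∀ X ∈ Λ 0, ((ρ (c X) : GL m F) : Matrix m m F) = cayley (ι X)) {X : V} (hX : X ∈ Λ 0) :
    ρ (c X) = cayleyGL (ι X) (isUnit_det_one_sub_of_valBound (valBound_of_mem_level_zero ι Λ hΛ hX) hα1).1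
      (isUnit_det_one_add_of_valBound (valBound_of_mem_level_zero ι Λ hΛ hX) hα1).1 :=
  Units.ext (by rw [hc X hX, coe_cayleyGL])

/-- **Hypothesis (I) of ★ (C3)**: `c (−W) = (c W)⁻¹`. [cite: PlatonovRapinchuk1994, §3.3] -/
theorem chart_inv (hΛ : ∀ j X, X ∈ Λ j ↔ ValBound (α ^ (j + 1)) (ι X)) (hα1 : α < 1) (hρinj : Function.Injective ρ)
    (hc : ∀ X ∈ Λ 0, ((ρ (c X) : GL m F) : Matrix m m F) = cayley (ι X)) :
    ∀ W ∈ Λ 0, ∃ W' ∈ Λ 0, c W' = (c W)⁻¹ := by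
  intro W hW
  refine ⟨-W, neg_mem hW, hρinj ?_⟩
  rw [map_inv, rho_chart_eq_cayleyGL ι Λ ρ c hΛ hα1 hc hW]
  apply Units.ext
  rw [hc _ (neg_mem hW), map_neg, coe_cayleyGL_inv]

end Algebra

/-! ## §2 The levels are open, compact, decreasing, with intersection `0` — a neighbourhood basis -/

section Levels

variable {F : Type*} [Field F] [ValuativeRel F] [TopologicalSpace F] [IsNonarchimedeanLocalField F]
  {m : Type*} [Fintype m]
  {V : Type*} [AddCommGroup V] [TopologicalSpace V]
  (ι : V →+ Matrix m m F) (Λ : ℕ → AddSubgroup V) {α : ValueGroupWithZero F}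

/-- The matrix box `{X | ValBound γ X}` is open for `γ ≠ 0`. [cite: PlatonovRapinchuk1994, §3.3] -/
theorem isOpen_setOf_valBound_matrix {γ : ValueGroupWithZero F} (hγ : γ ≠ 0) : IsOpen {X : Matrix m m F | ValBound γ X} := by
  have : {X : Matrix m m F | ValBound γ X} = ⋂ i, ⋂ j, (fun X : Matrix m m F => X i j) ⁻¹' {x : F | valuation F x ≤ γ} := by
    ext X; simp [ValBound]
  rw [this]
  exact isOpen_iInter_of_finite fun i => isOpen_iInter_of_finite fun j =>
    (DeltaCharBorel.isOpen_setOf_valuation_le hγ).preimage ((continuous_apply j).comp (continuous_apply i))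

omit [Fintype m] in
/-- The matrix box `{X | ValBound γ X}` is compact (product of compact balls of a local field). [cite: PlatonovRapinchuk1994, §3.3] -/
theorem isCompact_setOf_valBound_matrix (γ : ValueGroupWithZero F) : IsCompact {X : Matrix m m F | ValBound γ X} := by
  have : {X : Matrix m m F | ValBound γ X} = Set.univ.pi fun _ : m => Set.univ.pi fun _ : m => {x : F | valuation F x ≤ γ} := by
    ext X
    exact ⟨fun h i _ j _ => h i j, fun h i j => h i trivial j trivial⟩
  rw [this]
  exact isCompact_univ_pi fun _ => isCompact_univ_pi fun _ => IsNonarchimedeanLocalField.isCompact_closedBall F γ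

/-- The levels are open. [cite: Serre1992LALG, Part II Ch. IV §9] -/
theorem isOpen_level (hι : Continuous ι) (hΛ : ∀ j X, X ∈ Λ j ↔ ValBound (α ^ (j + 1)) (ι X)) (hα : α ≠ 0) (j : ℕ) :
    IsOpen (Λ j : Set V) := by
  have : (Λ j : Set V) = ι ⁻¹' {X : Matrix m m F | ValBound (α ^ (j + 1)) X} := by
    ext X; exact hΛ j X
  rw [this]
  exact (isOpen_setOf_valBound_matrix (pow_ne_zero _ hα)).preimage hι

omit [Fintype m] in
/-- The levels are compact (`ι` a closed embedding). [cite: Serre1992LALG, Part II Ch. IV §9] -/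
theorem isCompact_level (hι : IsClosedEmbedding ι) (hΛ : ∀ j X, X ∈ Λ j ↔ ValBound (α ^ (j + 1)) (ι X)) (j : ℕ) :
    IsCompact (Λ j : Set V) := by
  have : (Λ j : Set V) = ι ⁻¹' {X : Matrix m m F | ValBound (α ^ (j + 1)) X} := by
    ext X; exact hΛ j X
  rw [this]
  exact hι.isCompact_preimage (isCompact_setOf_valBound_matrix _)

omit [TopologicalSpace F] [Fintype m] [TopologicalSpace V] in
/-- `⋂ Λ j = 0`: an element of `V` whose `ι`-entries are `≤ α^(j+1)` for every `j` is `0` (`α < 1`; the value group of a local field is archimedean).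
[cite: Serre1992LALG, Part II Ch. IV §9] -/
theorem eq_zero_of_forall_mem_level [TopologicalSpace F] [IsNonarchimedeanLocalField F] (hinj : Function.Injective ι)
    (hΛ : ∀ j X, X ∈ Λ j ↔ ValBound (α ^ (j + 1)) (ι X)) (hα1 : α < 1) {X : V} (hX : ∀ j, X ∈ Λ j) : X = 0 := by
  apply hinj
  rw [map_zero]
  ext i j
  rw [Matrix.zero_apply]
  refine eq_zero_of_forall_valuation_le fun γ => ?_
  obtain ⟨n, hn⟩ := exists_pow_lt₀ hα1 γ
  have h := (hΛ n X).1 (hX n) i j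
  exact h.trans ((pow_le_pow_right_of_le_one' hα1.le (Nat.le_succ n)).trans hn.le)

omit [Fintype m] in
/-- **The levels are a neighbourhood basis of `0`** (compact closed decreasing family with intersection `{0}`). [cite: Serre1992LALG, Part II Ch. IV §9] -/
theorem exists_level_subset_of_mem_nhds [T2Space V] (hι : IsClosedEmbedding ι)
    (hΛ : ∀ j X, X ∈ Λ j ↔ ValBound (α ^ (j + 1)) (ι X)) (hα1 : α < 1) :
    ∀ U ∈ 𝓝 (0 : V), ∃ j, (Λ j : Set V) ⊆ U := by
  intro U hU
  have hanti := level_antitone ι Λ hΛ hα1.le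
  have hdir : Directed (· ⊇ ·) fun j => (Λ j : Set V) := hanti.directed_ge
  have hcl : ∀ j, IsClosed (Λ j : Set V) := fun j => (isCompact_level ι Λ hι hΛ j).isClosed
  refine exists_subset_nhds_of_isCompact' hdir (fun j => isCompact_level ι Λ hι hΛ j) hcl fun x hx => ?_
  obtain rfl : x = 0 := eq_zero_of_forall_mem_level ι Λ hι.injective hΛ hα1 fun j => Set.mem_iInter.1 hx j
  exact hU

end Levels

/-! ## §3 The chart: continuity, hypothesis (T) of ★ (C3), openness of the window -/

section Chart

variable {F : Type*} [Field F] [ValuativeRel F] [TopologicalSpace F] [IsNonarchimedeanLocalField F]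
  {m : Type*} [Fintype m] [DecidableEq m]
  {V : Type*} [AddCommGroup V] [TopologicalSpace V]
  {G : Type*} [Group G] [TopologicalSpace G]
  (ι : V →+ Matrix m m F) (Λ : ℕ → AddSubgroup V) {α : ValueGroupWithZero F}
  (ρ : G →* GL m F) (c : V → G) (σ : V → V → V)

/-- `X ↦ cayley (s • ι X)` (`s = ±1`) is continuous on the base box: matrix inversion is continuous where the determinant is a unit.
[cite: PlatonovRapinchuk1994, §3.3] -/
theorem continuousOn_cayley_smul (hι : Continuous ι) (hΛ : ∀ j X, X ∈ Λ j ↔ ValBound (α ^ (j + 1)) (ι X)) (hα1 : α < 1)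
    (s : F) (hs : s = 1 ∨ s = -1) : ContinuousOn (fun X : V => cayley (s • ι X)) (Λ 0 : Set V) := by
  intro X hX
  have hb : ValBound α (s • ι X) := by
    rcases hs with rfl | rfl
    · simpa using valBound_of_mem_level_zero ι Λ hΛ hX
    · simpa using (valBound_of_mem_level_zero ι Λ hΛ hX).neg
  obtain ⟨hu, -, -⟩ := isUnit_det_one_sub_of_valBound hb hα1
  have hcont_lin : Continuous fun X : V => s • ι X := hι.const_smul s
  have hinv : ContinuousAt Inv.inv (1 - s • ι X) := by
    refine continuousAt_matrix_inv _ ?_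
    rw [Ring.inverse_eq_inv']
    exact continuousAt_inv₀ hu.ne_zero
  have h1 : ContinuousAt (fun X : V => (1 - s • ι X)⁻¹) X :=
    ContinuousAt.comp (g := Inv.inv) (f := fun X : V => 1 - s • ι X) hinv (continuous_const.sub hcont_lin).continuousAt
  exact ((continuous_const.add hcont_lin).continuousAt.mul h1).continuousWithinAt

/-- **The chart is continuous on the base box** (`ρ` inducing; `GL_m` carries the units topology). [cite: PlatonovRapinchuk1994, §3.3] -/
theorem continuousOn_chart (hι : Continuous ι) (hΛ : ∀ j X, X ∈ Λ j ↔ ValBound (α ^ (j + 1)) (ι X)) (hα1 : α < 1)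
    (hρ : IsInducing ρ) (hc : ∀ X ∈ Λ 0, ((ρ (c X) : GL m F) : Matrix m m F) = cayley (ι X)) :
    ContinuousOn c (Λ 0 : Set V) := by
  rw [hρ.continuousOn_iff, Units.isInducing_embedProduct.continuousOn_iff]
  refine ContinuousOn.prodMk ?_ ?_
  · refine ((continuousOn_cayley_smul ι Λ hι hΛ hα1 1 (Or.inl rfl)).congr fun X hX => ?_)
    simp only [Function.comp_apply, one_smul]
    exact hc X hX
  · have hop : Continuous (MulOpposite.op : Matrix m m F → (Matrix m m F)ᵐᵒᵖ) := MulOpposite.continuous_op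
    refine ((hop.comp_continuousOn (continuousOn_cayley_smul ι Λ hι hΛ hα1 (-1) (Or.inr rfl))).congr fun X hX => ?_)
    simp only [Function.comp_apply, neg_smul, one_smul]
    rw [rho_chart_eq_cayleyGL ι Λ ρ c hΛ hα1 hc hX, coe_cayleyGL_inv]

omit [TopologicalSpace F] [IsNonarchimedeanLocalField F] [TopologicalSpace G] in
/-- **Hypothesis (T) of ★ (C3)**: left translation by `c W` is the Newton map `σ W` in the chart. [cite: Serre1992LALG, Part II Ch. IV §8] -/
theorem chart_translation_newton (hinj : Function.Injective ι) (hΛ : ∀ j X, X ∈ Λ j ↔ ValBound (α ^ (j + 1)) (ι X)) (hα1 : α < 1)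
    (hρinj : Function.Injective ρ) (hc : ∀ X ∈ Λ 0, ((ρ (c X) : GL m F) : Matrix m m F) = cayley (ι X))
    (hσ : ∀ W ∈ Λ 0, ∀ X ∈ Λ 0, ι (σ W X) = (1 - ι W)⁻¹ * (ι W + ι X) * (1 + ι W * ι X)⁻¹ * (1 - ι W))
    (hσc : ∀ W ∈ Λ 0, ContinuousOn (σ W) (Λ 0 : Set V)) :
    ∀ W ∈ Λ 0, ∃ ψ : V → V, ContinuousOn ψ (Λ 0 : Set V) ∧ ψ 0 ∈ Λ 0 ∧
      (∀ j, 0 ≤ j → ∀ x ∈ Λ 0, ∀ y ∈ Λ j, ψ (x + y) - ψ x - y ∈ Λ (j + 1)) ∧ ∀ X ∈ Λ 0, c (ψ X) = c W * c X :=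
  fun W hW => ⟨σ W, hσc W hW, by rw [sigma_zero ι Λ σ hinj hΛ hα1 hσ hW]; exact hW,
    sigma_newton ι Λ σ hΛ hα1 hσ hW, fun X hX => chart_sigma ι Λ ρ c σ hΛ hα1 hρinj hc hσ hW hX⟩

/-- The window `K = c '' Λ 0` is closed under products (★ (C3) §1) and contains the `ρ`-ball of radius `β`, hence is OPEN in `G`.
[cite: Serre1992LALG, Part II Ch. IV §8] -/
theorem isOpen_image_chart [IsTopologicalAddGroup V] [T2Space V] [IsTopologicalGroup G] (hι : IsClosedEmbedding ι)
    (hΛ : ∀ j X, X ∈ Λ j ↔ ValBound (α ^ (j + 1)) (ι X)) (hα : α ≠ 0) (hα1 : α < 1)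
    (hρ : IsInducing ρ) (hρinj : Function.Injective ρ)
    (hc : ∀ X ∈ Λ 0, ((ρ (c X) : GL m F) : Matrix m m F) = cayley (ι X))
    (hσ : ∀ W ∈ Λ 0, ∀ X ∈ Λ 0, ι (σ W X) = (1 - ι W)⁻¹ * (ι W + ι X) * (1 + ι W * ι X)⁻¹ * (1 - ι W))
    (hσc : ∀ W ∈ Λ 0, ContinuousOn (σ W) (Λ 0 : Set V))
    {β : ValueGroupWithZero F} (hβ : β ≠ 0) (hwin : ∀ g : G, ValBound β (((ρ g : GL m F) : Matrix m m F) - 1) → g ∈ c '' (Λ 0 : Set V)) :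
    IsOpen (c '' (Λ 0 : Set V)) := by
  -- the `ρ`-ball `U = {g | ValBound β (ρ g − 1)}` is an open neighbourhood of `1` inside the window
  set U : Set G := {g | ValBound β (((ρ g : GL m F) : Matrix m m F) - 1)} with hU
  have hUo : IsOpen U := by
    have : U = (fun g : G => ((ρ g : GL m F) : Matrix m m F) - 1) ⁻¹' {X | ValBound β X} := rfl
    rw [this]
    refine (isOpen_setOf_valBound_matrix hβ).preimage ?_
    exact (Units.continuous_val.comp hρ.continuous).sub continuous_const
  have hUK : U ⊆ c '' (Λ 0 : Set V) := fun g hg => hwin g hg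
  have hanti := level_antitone ι Λ hΛ hα1.le
  have hT := chart_translation_newton ι Λ ρ c σ hι.injective hΛ hα1 hρinj hc hσ hσc
  have hopen := isOpen_level ι Λ hι.continuous hΛ hα
  have hcomp := isCompact_level ι Λ hι hΛ 0
  have hbasis := exists_level_subset_of_mem_nhds ι Λ hι hΛ hα1
  rw [isOpen_iff_mem_nhds]
  intro g hg
  have hsub : (fun x => g * x) '' U ⊆ c '' (Λ 0 : Set V) := by
    rintro _ ⟨u, hu, rfl⟩
    obtain ⟨W, hW, rfl⟩ := hg
    obtain ⟨X, hX, rfl⟩ := hUK hu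
    exact mul_mem_image Λ c hanti hopen hcomp hbasis hT hW hX
  have himg : IsOpen ((fun x => g * x) '' U) := (Homeomorph.mulLeft g).isOpenMap U hUo
  refine Filter.mem_of_superset (himg.mem_nhds ⟨1, ?_, by simp⟩) hsub
  show ValBound β (((ρ 1 : GL m F) : Matrix m m F) - 1)
  rw [map_one, Units.val_one, sub_self]
  exact valBound_zero β

end Chart

/-! ## §4 Haar measure on the window is the Cayley image of additive Haar measure on the Lie ball -/

section Haar

variable {F : Type*} [Field F] [ValuativeRel F] [TopologicalSpace F] [IsNonarchimedeanLocalField F]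
  {m : Type*} [Fintype m] [DecidableEq m]
  {V : Type*} [AddCommGroup V] [TopologicalSpace V] [IsTopologicalAddGroup V] [T2Space V] [SecondCountableTopology V]
  [MeasurableSpace V] [BorelSpace V]
  {G : Type*} [Group G] [TopologicalSpace G] [IsTopologicalGroup G] [LocallyCompactSpace G] [SecondCountableTopology G] [T2Space G]
  [MeasurableSpace G] [BorelSpace G]
  (ι : V →+ Matrix m m F) (Λ : ℕ → AddSubgroup V) {α : ValueGroupWithZero F}
  (ρ : G →* GL m F) (c : V → G) (σ : V → V → V)
  (μ : Measure V) [μ.IsAddHaarMeasure] (ν : Measure G) [ν.IsHaarMeasure]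

/-- **THE CAYLEY CHART CARRIES HAAR MEASURE**: `(μ.restrict (Λ 0)).map c = (μ (Λ 0) ∕ ν K) • ν.restrict K`, `K = c '' Λ 0`.
[cite: Helgason2000, Ch. I §1 Thm. 1.14 (13) p. 96] [cite: Serre1992LALG, Part II Ch. IV §9] -/
theorem map_restrict_chart_eq_smul_haar (hι : IsClosedEmbedding ι)
    (hΛ : ∀ j X, X ∈ Λ j ↔ ValBound (α ^ (j + 1)) (ι X)) (hα : α ≠ 0) (hα1 : α < 1)
    (hρ : IsInducing ρ) (hρinj : Function.Injective ρ)
    (hc : ∀ X ∈ Λ 0, ((ρ (c X) : GL m F) : Matrix m m F) = cayley (ι X))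
    (hσ : ∀ W ∈ Λ 0, ∀ X ∈ Λ 0, ι (σ W X) = (1 - ι W)⁻¹ * (ι W + ι X) * (1 + ι W * ι X)⁻¹ * (1 - ι W))
    (hσc : ∀ W ∈ Λ 0, ContinuousOn (σ W) (Λ 0 : Set V))
    {β : ValueGroupWithZero F} (hβ : β ≠ 0) (hwin : ∀ g : G, ValBound β (((ρ g : GL m F) : Matrix m m F) - 1) → g ∈ c '' (Λ 0 : Set V)) :
    (μ.restrict (Λ 0 : Set V)).map c = (μ (Λ 0 : Set V) / ν (c '' (Λ 0 : Set V))) • ν.restrict (c '' (Λ 0 : Set V)) :=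
  map_restrict_eq_smul_haar Λ c μ ν (level_antitone ι Λ hΛ hα1.le) (isOpen_level ι Λ hι.continuous hΛ hα)
    (isCompact_level ι Λ hι hΛ 0) (exists_level_subset_of_mem_nhds ι Λ hι hΛ hα1)
    (continuousOn_chart ι Λ ρ c hι.continuous hΛ hα1 hρ hc)
    (isOpen_image_chart ι Λ ρ c σ hι hΛ hα hα1 hρ hρinj hc hσ hσc hβ hwin)
    (chart_translation_newton ι Λ ρ c σ hι.injective hΛ hα1 hρinj hc hσ hσc) (chart_inv ι Λ ρ c hΛ hα1 hρinj hc)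

/-- **Measures of chart images**: `μ A = (μ (Λ 0) ∕ ν K) · ν (c '' A)` for `A ⊆ Λ 0` with Borel image (`2 ≠ 0` for injectivity).
[cite: Helgason2000, Ch. I §1 Thm. 1.14 (13) p. 96] [cite: Serre1992LALG, Part II Ch. IV §9] -/
theorem measure_chart_image_eq (h2 : (2 : F) ≠ 0) (hι : IsClosedEmbedding ι)
    (hΛ : ∀ j X, X ∈ Λ j ↔ ValBound (α ^ (j + 1)) (ι X)) (hα : α ≠ 0) (hα1 : α < 1)
    (hρ : IsInducing ρ) (hρinj : Function.Injective ρ)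
    (hc : ∀ X ∈ Λ 0, ((ρ (c X) : GL m F) : Matrix m m F) = cayley (ι X))
    (hσ : ∀ W ∈ Λ 0, ∀ X ∈ Λ 0, ι (σ W X) = (1 - ι W)⁻¹ * (ι W + ι X) * (1 + ι W * ι X)⁻¹ * (1 - ι W))
    (hσc : ∀ W ∈ Λ 0, ContinuousOn (σ W) (Λ 0 : Set V))
    {β : ValueGroupWithZero F} (hβ : β ≠ 0) (hwin : ∀ g : G, ValBound β (((ρ g : GL m F) : Matrix m m F) - 1) → g ∈ c '' (Λ 0 : Set V))
    {A : Set V} (hA : A ⊆ (Λ 0 : Set V)) (hAm : MeasurableSet (c '' A)) :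
    μ A = (μ (Λ 0 : Set V) / ν (c '' (Λ 0 : Set V))) * ν (c '' A) :=
  measure_image_eq Λ c μ ν (level_antitone ι Λ hΛ hα1.le) (isOpen_level ι Λ hι.continuous hΛ hα)
    (isCompact_level ι Λ hι hΛ 0) (exists_level_subset_of_mem_nhds ι Λ hι hΛ hα1)
    (continuousOn_chart ι Λ ρ c hι.continuous hΛ hα1 hρ hc) (injOn_chart ι Λ ρ c h2 hι.injective hΛ hα1 hc)
    (isOpen_image_chart ι Λ ρ c σ hι hΛ hα hα1 hρ hρinj hc hσ hσc hβ hwin)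
    (chart_translation_newton ι Λ ρ c σ hι.injective hΛ hα1 hρinj hc hσ hσc) (chart_inv ι Λ ρ c hΛ hα1 hρinj hc) hA hAm

end Haar

end Summit.HodgeConjecture.HodgeConjecture.Cruxes.H413.F0P3cStCharTSCayleyChartHaar
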